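import Summits.BirchSwinnertonDyer.Rank1Residual.P2.ShuZhaiThirtySixIsogenyClass
import Literature.NumberTheory.EllipticCurves.ShuZhai2021.Table52Row36a1
import HarnessLib

/-!
# Cell `bsd-print-cf2` (D-0131 (2) PRINT TIER, leaf CornerF @ `p = 2`), prover p3 — file 5: the
# Shu–Zhai `36a1` slice of `WAllCornerFTwo` ENTIRELY BY NAME — the two display hypotheses replaced by
# the printed Table row (Shu–Zhai 2021 §5.2, row `36a1`) as ONE named fact; membership predicates (models /
# isogeny class) and closers in the shape of route `PrintCf2` item 20363 `InertTwoRankOneOfFacts`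

HONEST FRAMING. Companion of `P2/ShuZhaiThirtySixCurve.lean`, `…Admissible.lean`, `…Slices.lean`,
`…Reduction.lean` (HONEST FRAMING in `…Slices.lean`). The leaf `Summit.BirchSwinnertonDyer.WAllCornerFTwo`
is OPEN AS A CLASS; nothing class-wide is closed. NO named fact is introduced here; the ONE
non-kernel input is the Literature fact `ShuZhai2021.table52_row36a1` (typed by this seat, statement only,
D-0014) — the content of row `36a1` of Shu–Zhai's Table (§5.2, caption "E/ℚ
satisfying `f([0]) ∉ 2E(ℚ)` and Condition (Tor) with conductor `N < 100`"; `E` optimal, §1 p. 1) that the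
kernel cannot evaluate: an optimal parametrisation datum of `36a1` at level `N(E)` with `f([0]) ∉ 2E(ℚ)`
((Tor) itself is the kernel theorem `natCard_twoTorsion_curve36a1`). With it, the explicit slice of
file 3 (`cornerFTwo_shuZhaiThirtySix_explicit`) loses its last display binders: granted BY NAME
Shu–Zhai Thm 1.2 / 1.4, row C8 (BF24), modularity, Agashe–Ribet–Stein 2006 Thm 2.6 and the Table row,
every globally minimal model of `36a1^{(−p∏q)}` (`p ≡ 23 (mod 24)` prime, `Q ⊂ {primes ≡ 5 (mod 12)}`,
`∏q ≡ 1 (mod 24)`) satisfies `ord_{s=1} L = 1` and `BSD(·,2)` (`…_of_isShuZhaiThirtySixTwist`), and lies in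
the slice `WAllCornerFTwoInertBad` (`placement_of_isShuZhaiThirtySixTwist`). The membership predicate
`IsShuZhaiThirtySixTwist W` is a definition with a body (data: `p`, `Q`, the `ℚ`-isomorphism `C`). The
closer `cornerFTwo_shuZhaiThirtySix_byName` has the binder shape of route `PrintCf2` item 20363
(`… → ∀ W, W.HasCM → W.analyticRank = 1 → CMInert W 2 → … → BSDp W 2`) restricted to the family —
the ON-FAMILY half of a layer-2 split of that crux (the OFF-FAMILY half stays open). beyond-print: NO.

References: [ShuZhai2021] §1 p. 1, Thm 1.2, Thm 1.4, §5.2 Table row 36a1 (arXiv:2102.11808 chunks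
p0003 L3, p0014 L67–L87); [Cremona1997] Table 1 (36a1 optimal); [AgasheRibetStein2006] Thm 2.6;
[BurungaleFlach2024] Thm 1.1, Cor 2; [Miller2011LMS] Def 1.1.
-/

noncomputable section

open scoped Classical

open WeierstrassCurve NumberField Literature.NumberTheory.EllipticCurves
  Literature.NumberTheory.EllipticCurves.Rank1Residual
  Literature.NumberTheory.EllipticCurves.ModularForms
  Literature.NumberTheory.EllipticCurves.ShuZhai2021
  Summit.BirchSwinnertonDyer.Rank1Residual

set_option autoImplicit false

namespace Summit.BirchSwinnertonDyer.Rank1Residual.P2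

/-! ## §1 (The printed Table row is the Literature fact `ShuZhai2021.table52_row36a1`.) -/

/-! ## §2 Membership predicate of the explicit family -/

/-- **`W` is a `ℚ`-model of an explicit Shu–Zhai twist of `36a1`**: there are a prime `p ≡ 23 (mod 24)`,
a finite set `Q` of primes `≡ 5 (mod 12)` with `∏ q ≡ 1 (mod 24)`, and a `ℚ`-isomorphism
`C • 36a1^{(−p∏q)} = W` (`36a1^{(d)}` = `curve36a1.quadraticTwist d : y² = x³ − 3d x² + 3d² x ≅ Y² = X³ + d³`).
A definition with a body (data), not a named fact. [cite: ShuZhai2021, Thm. 1.2, Thm. 1.4 and §5.2 Table row 36a1] -/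
def IsShuZhaiThirtySixTwist (W : WeierstrassCurve ℚ) : Prop :=
  ∃ (p : ℕ) (Q : Finset ℕ) (C : VariableChange ℚ), p.Prime ∧ p % 24 = 23 ∧
    (∀ q ∈ Q, q.Prime ∧ q % 12 = 5) ∧ (∏ q ∈ Q, q) % 24 = 1 ∧
    C • curve36a1.quadraticTwist (-((p * ∏ q ∈ Q, q : ℕ) : ℚ)) = W

/-- The `r = 0` members: every `ℚ`-model of `36a1^{(−p)}`, `p ≡ 23 (mod 24)` prime, is in the family
(`Q = ∅`). [cite: ShuZhai2021, Thm. 1.2 (r = 0)] -/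
theorem isShuZhaiThirtySixTwist_of_prime {p : ℕ} (hp : p.Prime) (h24 : p % 24 = 23)
    {W : WeierstrassCurve ℚ} {C : VariableChange ℚ} (hC : C • curve36a1.quadraticTwist (-(p : ℚ)) = W) :
    IsShuZhaiThirtySixTwist W :=
  ⟨p, ∅, C, hp, h24, fun q hq => absurd hq (Finset.notMem_empty q), by simp, by simpa using hC⟩

/-! ## §3 The slice BY NAME (no display binder) -/

/-- **`ord_{s=1} L(W,s) = 1 ∧ BSD(W,2)` on the explicit Shu–Zhai family of `36a1`, ENTIRELY BY NAME**:
granted Shu–Zhai Thm 1.2 (`h12`) and Thm 1.4 (`h14`), the CM rank-zero row C8 (`hCM`), modularity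
(`hmod`), Agashe–Ribet–Stein 2006 Thm 2.6 (`hARS`, odd Manin constant) and the Table row (`htab`:
`36a1` optimal with `f([0]) ∉ 2E(ℚ)`). The instance and datum packed in `htab` are unpacked and handed to
`analyticRank_eq_one_and_bsdp_two_of_twist_curve36a1_explicit` (the `NeZero` witness is a proof, any two
agree). [cite: ShuZhai2021, Thm. 1.2, Thm. 1.4, §5.2 Table row 36a1] [cite: AgasheRibetStein2006, Thm. 2.6]
[cite: BurungaleFlach2024, Thm. 1.1 and Cor. 2] [cite: Miller2011LMS, Def. 1.1] -/
theorem analyticRank_eq_one_and_bsdp_two_of_isShuZhaiThirtySixTwist (h12 : thm12_ranks_of_twists)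
    (h14 : thm14_twoPartBSD_of_twists) (hCM : bsdTriple_of_hasCM_of_L_one_ne_zero)
    (hmod : hasEntireLFunction_rat)
    (hARS : AgasheRibetStein2006.cremona_abs_maninConstant_eq_one_of_level_le)
    (htab : table52_row36a1) (W : WeierstrassCurve ℚ) [W.IsElliptic] [W.IsGloballyMinimal]
    (hW : IsShuZhaiThirtySixTwist W) : W.analyticRank = 1 ∧ BSDp W 2 := by
  obtain ⟨_, Dt, hopt, hcusp⟩ := htab
  obtain ⟨p, Q, C, hp, h24, hQ, hM, hC⟩ := hW
  exact analyticRank_eq_one_and_bsdp_two_of_twist_curve36a1_explicit h12 h14 hCM hmod Dt hopt hcusp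
    (not_two_dvd_c_of_isOptimalDatum_curve36a1 hARS Dt hopt) hp h24 hQ hM W ⟨C, hC⟩

/-- **Placement of the family** (unconditional): every globally minimal model of a member has CM
(`j = 0`), `2` INERT in its CM field `ℚ(√−3)` and BAD reduction at `2` — it lies in the slice
`WAllCornerFTwoInertBad` of `WAll/TargetCMTwoSlices.lean` and in `CornerF♯` at `2`.
[cite: ShuZhai2021, §5.2 Table row 36a1] [cite: SilvermanAEC2009, VII.5 Prop. 5.1(a)] -/
theorem placement_of_isShuZhaiThirtySixTwist (W : WeierstrassCurve ℚ) [W.IsElliptic] [W.IsGloballyMinimal]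
    (hW : IsShuZhaiThirtySixTwist W) : W.HasCM ∧ CMInert W 2 ∧ ¬ Good W 2 := by
  obtain ⟨p, Q, C, hp, h24, hQ, -, hC⟩ := hW
  have hm0 : p * ∏ q ∈ Q, q ≠ 0 :=
    Nat.pos_iff_ne_zero.mp (Nat.mul_pos hp.pos (Finset.prod_pos fun q hq => (hQ q hq).1.pos))
  have hd : (-((p * ∏ q ∈ Q, q : ℕ) : ℚ)) ≠ 0 := neg_ne_zero.mpr (by exact_mod_cast hm0)
  exact ⟨hasCM_of_smul_twist_curve36a1 hd hC, cmInert_and_not_good_two_of_twist_curve36a1 hp h24 hQ hC⟩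

/-- **SLICE SZ36 BY NAME, in the binder shape of route `PrintCf2` item 20363 `InertTwoRankOneOfFacts`
restricted to the family** (`… → ∀ W, W.HasCM → W.analyticRank = 1 → CMInert W 2 → IsShuZhaiThirtySixTwist W
→ BSDp W 2`; the three leaf/slice hypotheses are implied by membership and not used): the ON-FAMILY half
of a layer-2 split of that crux, closed granted the facts `h12 h14 hCM hmod hARS htab` BY NAME.
beyond-print: NO. [cite: ShuZhai2021, Thm. 1.2, Thm. 1.4, §5.2 Table row 36a1]
[cite: AgasheRibetStein2006, Thm. 2.6] [cite: BurungaleFlach2024, Cor. 2] [cite: Miller2011LMS, Def. 1.1] -/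
theorem cornerFTwo_shuZhaiThirtySix_byName (h12 : thm12_ranks_of_twists) (h14 : thm14_twoPartBSD_of_twists)
    (hCM : bsdTriple_of_hasCM_of_L_one_ne_zero) (hmod : hasEntireLFunction_rat)
    (hARS : AgasheRibetStein2006.cremona_abs_maninConstant_eq_one_of_level_le)
    (htab : table52_row36a1) :
    ∀ (W : WeierstrassCurve ℚ) [W.IsElliptic] [W.IsGloballyMinimal], W.HasCM → W.analyticRank = 1 →
      CMInert W 2 → IsShuZhaiThirtySixTwist W → BSDp W 2 :=
  fun W _ _ _ _ _ hW =>
    (analyticRank_eq_one_and_bsdp_two_of_isShuZhaiThirtySixTwist h12 h14 hCM hmod hARS htab W hW).2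

/-- **Leaf-shape form** (`WAllCornerFTwo` restricted to the family), BY NAME. [cite: ShuZhai2021, Thm. 1.2, Thm. 1.4, §5.2 Table row 36a1] -/
theorem cornerFTwo_shuZhaiThirtySix_byName' (h12 : thm12_ranks_of_twists) (h14 : thm14_twoPartBSD_of_twists)
    (hCM : bsdTriple_of_hasCM_of_L_one_ne_zero) (hmod : hasEntireLFunction_rat)
    (hARS : AgasheRibetStein2006.cremona_abs_maninConstant_eq_one_of_level_le)
    (htab : table52_row36a1) :
    ∀ (W : WeierstrassCurve ℚ) [W.IsElliptic] [W.IsGloballyMinimal], W.HasCM → W.analyticRank = 1 →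
      IsShuZhaiThirtySixTwist W → BSDp W 2 :=
  fun W _ _ _ _ hW =>
    (analyticRank_eq_one_and_bsdp_two_of_isShuZhaiThirtySixTwist h12 h14 hCM hmod hARS htab W hW).2

/-! ## §4 The isogeny-class version, BY NAME (Cassels' invariance is a conjunct of 𝔅_inert) -/

/-- **`W` is `ℚ`-ISOGENOUS to an explicit Shu–Zhai twist of `36a1`** (`p ≡ 23 (mod 24)` prime, `Q` primes
`≡ 5 (mod 12)` with `∏ q ≡ 1 (mod 24)`): the isogeny-class form of `IsShuZhaiThirtySixTwist` (it contains
every model of the twists of `36a1`, `36a2`, `36a3`, `36a4`). A definition with a body (data `p`, `Q`).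
[cite: ShuZhai2021, Thm. 1.2, Thm. 1.4 and §5.2 Table row 36a1] -/
def IsIsogenousToShuZhaiThirtySixTwist (W : WeierstrassCurve ℚ) : Prop :=
  ∃ (p : ℕ) (Q : Finset ℕ), p.Prime ∧ p % 24 = 23 ∧ (∀ q ∈ Q, q.Prime ∧ q % 12 = 5) ∧
    (∏ q ∈ Q, q) % 24 = 1 ∧ IsIsogenous W (curve36a1.quadraticTwist (-((p * ∏ q ∈ Q, q : ℕ) : ℚ)))

/-- Models are isogenous (an isomorphism is an isogeny). [cite: SilvermanAEC2009, III.4] -/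
theorem isIsogenousToShuZhaiThirtySixTwist_of_isShuZhaiThirtySixTwist {W : WeierstrassCurve ℚ}
    (hW : IsShuZhaiThirtySixTwist W) : IsIsogenousToShuZhaiThirtySixTwist W := by
  obtain ⟨p, Q, C, hp, h24, hQ, hM, hC⟩ := hW
  exact ⟨p, Q, hp, h24, hQ, hM, isIsogenous_of_smul_eq' hC⟩

/-- **`ord_{s=1} L = 1 ∧ BSD(W,2)` on the ISOGENY CLASSES of the explicit Shu–Zhai twists of `36a1`,
ENTIRELY BY NAME** (binders `hCassels h12 h14 hCM hmod hARS htab`).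
[cite: ShuZhai2021, Thm. 1.2, Thm. 1.4, §5.2 Table row 36a1] [cite: MilneADT2006, Thm. I.7.3]
[cite: AgasheRibetStein2006, Thm. 2.6] -/
theorem analyticRank_eq_one_and_bsdp_two_of_isIsogenousToShuZhaiThirtySixTwist
    (hCassels : bsdRHS_eq_of_isIsogenous) (h12 : thm12_ranks_of_twists) (h14 : thm14_twoPartBSD_of_twists)
    (hCM : bsdTriple_of_hasCM_of_L_one_ne_zero) (hmod : hasEntireLFunction_rat)
    (hARS : AgasheRibetStein2006.cremona_abs_maninConstant_eq_one_of_level_le)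
    (htab : table52_row36a1) (W : WeierstrassCurve ℚ) [W.IsElliptic] [W.IsGloballyMinimal]
    (hW : IsIsogenousToShuZhaiThirtySixTwist W) : W.analyticRank = 1 ∧ BSDp W 2 := by
  obtain ⟨_, Dt, hopt, hcusp⟩ := htab
  obtain ⟨p, Q, hp, h24, hQ, hM, hiso⟩ := hW
  exact analyticRank_eq_one_and_bsdp_two_of_isIsogenous_twist_curve36a1_explicit hCassels h12 h14 hCM hmod Dt
    hopt hcusp (not_two_dvd_c_of_isOptimalDatum_curve36a1 hARS Dt hopt) hp h24 hQ hM W hiso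

/-- **Placement of the isogeny classes** (unconditional): CM and `2` inert in the CM field.
[cite: SilvermanAEC2009, Cor. III.9.4] -/
theorem hasCM_and_cmInert_two_of_isIsogenousToShuZhaiThirtySixTwist (W : WeierstrassCurve ℚ) [W.IsElliptic]
    (hW : IsIsogenousToShuZhaiThirtySixTwist W) : W.HasCM ∧ CMInert W 2 := by
  obtain ⟨p, Q, hp, -, hQ, -, hiso⟩ := hW
  have hm0 : p * ∏ q ∈ Q, q ≠ 0 :=
    Nat.pos_iff_ne_zero.mp (Nat.mul_pos hp.pos (Finset.prod_pos fun q hq => (hQ q hq).1.pos))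
  exact hasCM_and_cmInert_two_of_isIsogenous_twist_curve36a1
    (neg_ne_zero.mpr (by exact_mod_cast hm0)) W hiso

/-- **SLICE SZ36-ISOGENY-CLASS BY NAME, in the binder shape of item 20363** (`… → ∀ W, W.HasCM →
W.analyticRank = 1 → CMInert W 2 → IsIsogenousToShuZhaiThirtySixTwist W → BSDp W 2`), closed granted
`hCassels h12 h14 hCM hmod hARS htab`. beyond-print: NO. [cite: ShuZhai2021, Thm. 1.2, Thm. 1.4, §5.2 Table row 36a1]
[cite: MilneADT2006, Thm. I.7.3] [cite: AgasheRibetStein2006, Thm. 2.6] [cite: Miller2011LMS, Def. 1.1] -/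
theorem cornerFTwo_shuZhaiThirtySix_isogenyClass_byName (hCassels : bsdRHS_eq_of_isIsogenous)
    (h12 : thm12_ranks_of_twists) (h14 : thm14_twoPartBSD_of_twists)
    (hCM : bsdTriple_of_hasCM_of_L_one_ne_zero) (hmod : hasEntireLFunction_rat)
    (hARS : AgasheRibetStein2006.cremona_abs_maninConstant_eq_one_of_level_le)
    (htab : table52_row36a1) :
    ∀ (W : WeierstrassCurve ℚ) [W.IsElliptic] [W.IsGloballyMinimal], W.HasCM → W.analyticRank = 1 →
      CMInert W 2 → IsIsogenousToShuZhaiThirtySixTwist W → BSDp W 2 :=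
  fun W _ _ _ _ _ hW =>
    (analyticRank_eq_one_and_bsdp_two_of_isIsogenousToShuZhaiThirtySixTwist hCassels h12 h14 hCM hmod hARS
      htab W hW).2

end Summit.BirchSwinnertonDyer.Rank1Residual.P2

end
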